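import Mathlib
import Summits.ValiantsHypothesis.ValiantsHypothesis.Theorems.GeneratorObstructionsPowGenDegreeQPWideAtoms
import Literature.Computability.AlgebraicComplexity.MS2001TracePowerPolystable

/-!
# Route GeneratorObstructions — crux K2 `PowGenDegreeQP` (stmt-ValiantsHypothesis-11655), line
# `trace-side-regimes`: the SLICE regime is non-vacuous — constant-weight slice generator types of
# degree `≥ m²` in every window cell

Helper file (`--supports stmt-ValiantsHypothesis-11655`).  The registered `stub_sliceGen` bounds the
degree of the generator types `ext_ι χ` of `A(Δ_m[tr X_{m+e}^m])` supported on the final `m²`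
letters.  This file shows, unconditionally, that such generator types EXIST with degree at least
`m²`, for every `m ≥ 2` and every cell `(m, e)`:

1. `tracePow_eq_powTrace` — the two tree spellings of `tr X_n^m` agree (`rfl`);
2. `powFormLex_self_exists_hasHighestWeight_const` — for `m ≥ 2` some constant weight `-k·𝟙`
   (`k > 0`) OCCURS in `ℂ[Δ_m[tr X_m^m]]`: `tr X_m^m` is polystable (Mulmuley–Sohoni 2001 §4.1
   Remark, tree `MS2001_rem_4_1_trace_thm_4_6_analogue_complex`, Kempf's criterion), Hilbert's
   nonvanishing invariant (tree `exists_hasHighestWeight_const_of_isPolystable`), transported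
   `Fin (m·m) → MatIdx m`;
3. `exists_const_genType_self` — hence the least occurring constant weight `-k₀·𝟙_{m²}` is a
   generator type of `A(Δ_m[tr X_m^m])` (`exists_least_const_atom`, `finrank_quotient_ne_zero_of_atom`
   of the companion file) with `m ≤ k₀`, i.e. degree `k₀ m ≥ m²`;
4. `exists_slice_genType_sq_le` — **in every window cell `(m, e)`, `m ≥ 2`, and for every final
   segment `ι`, the slice regime of `stub_sliceGen` contains a generator type `ext_ι χ` with
   `-|χ| ≥ m · m²`** (transfer engine `finrank_ne_zero_extend_of_rename_mem_orbitClosure` along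
   `ι(tr X_m^m) ∈ Δ(tr X_{m+e}^m)`, GIP17 Prop. 5).  So the stub's quasi-polynomial bound has to
   absorb degree `m²` at the least (consistent; the content of the stub is whether anything beyond
   quasi-polynomial degree occurs).

Honest framing: calibration (non-vacuity, polynomial lower end of the slice regime); `stub_sliceGen`,
`stub_wideGen`, K2, K1, `GenFlipThesis` remain OPEN; `VP ≠ VNP` is not touched.

References: Mulmuley–Sohoni, SIAM J. Comput. 31 (2001) §4.1 (Remark after Thm. 4.6);
Bürgisser–Ikenmeyer, J. Algebra 477 (2017) §3.3; Gesmundo–Ikenmeyer–Panova, Diff. Geom. Appl. 55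
(2017) Prop. 5.
-/

namespace Summit.ValiantsHypothesis.ValiantsHypothesis.Theorems.GeneratorObstructions.PowGenDegreeQP

open MvPolynomial
open Literature.NumberTheory.DiophantineGeometry Literature.Computability.AlgebraicComplexity
open Summit.ValiantsHypothesis.ValiantsHypothesis.Theses.GeneratorObstructions
open Summit.ValiantsHypothesis.ValiantsHypothesis.Theorems.GenInheritance
open Summit.ValiantsHypothesis.ValiantsHypothesis.Theorems.GeneratorObstructions.SliceTransfer
open Summit.ValiantsHypothesis.ValiantsHypothesis.Theorems.GeneratorObstructions.PerGenDegreeSuperQP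

-- `Summit.ValiantsHypothesis.ValiantsHypothesis.…` is the tree's mandated single-conjunct layout.
set_option linter.dupNamespace false

noncomputable section

section Self

variable {m : ℕ}

/-- The two tree spellings of the power trace `tr X_n^m` on `Fin n × Fin n` agree
(`MS2001TracePowerRemark.tracePow` and `PowerTraceStabilizer.powTrace`). [folklore] -/
theorem tracePow_eq_powTrace (n m : ℕ) : tracePow ℂ n m = powTrace ℂ n m := rfl

/-- `tr X_n^m` numbered by `Fin (n·n)` and then placed lexicographically is `powFormLex ℂ n m`.
[folklore] -/
theorem rename_powTraceFin_eq_powFormLex (n m : ℕ) :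
    rename (fun i : Fin (n * n) => (toLex (finProdFinEquiv.symm i) : MatIdx n))
        (rename (finProdFinEquiv : Fin n × Fin n ≃ Fin (n * n)) (powTrace ℂ n m)) =
      powFormLex ℂ n m := by
  have h : ((fun i : Fin (n * n) => (toLex (finProdFinEquiv.symm i) : MatIdx n)) ∘
      (finProdFinEquiv : Fin n × Fin n ≃ Fin (n * n)) : Fin n × Fin n → MatIdx n) = toLex := by
    funext ij
    simp only [Function.comp_apply, Equiv.symm_apply_apply]
  rw [rename_rename, h]
  rfl

/-- `tr X_n^m` is a form of degree `m` (letters `Fin n × Fin n`). [folklore] -/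
theorem powTrace_isHomogeneous (n m : ℕ) : (powTrace ℂ n m).IsHomogeneous m := by
  unfold powTrace Matrix.trace
  exact IsHomogeneous.sum _ _ _ fun i _ => by
    simpa using mvPolynomialX_pow_apply_isHomogeneous (k := ℂ) n m i i

/-- **`tr X_m^m` has an occurring constant weight** (`m ≥ 2`): some `-k·𝟙`, `k ≥ 1`, occurs in
`ℂ[Δ_m[tr X_m^m]]` — polystability of `trace(Y^m)` (Mulmuley–Sohoni 2001 §4.1 Remark, tree
`MS2001_rem_4_1_trace_thm_4_6_analogue_complex`), Hilbert's nonvanishing invariant at a closed orbit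
(tree `exists_hasHighestWeight_const_of_isPolystable`) and transport along `Fin (m·m) → MatIdx m`
(tree `hasHighestWeight_orbitCoordRep_rename_dualOfPartition_iff`).
[cite: MulmuleySohoni2001, §4.1 Remark after Thm. 4.6] -/
theorem powFormLex_self_exists_hasHighestWeight_const (hm : 2 ≤ m) :
    ∃ k : ℕ, 0 < k ∧
      highestWeightSpace (orbitCoordRep (powFormLex ℂ m m) m) (fun _ : MatIdx m => -(k : ℤ)) ≠ ⊥ := by
  classical
  set e : Fin m × Fin m ≃ Fin (m * m) := finProdFinEquiv with he
  set p : MvPolynomial (Fin (m * m)) ℂ := rename e (powTrace ℂ m m) with hpdef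
  have hp : p.IsHomogeneous m := (powTrace_isHomogeneous m m).rename_isHomogeneous
  have hp0 : p ≠ 0 := by
    intro h
    have hinj := rename_injective (R := ℂ) (e : Fin m × Fin m → Fin (m * m)) e.injective
    have h0 : powTrace ℂ m m = 0 := hinj (by rw [← hpdef, h, map_zero])
    apply powFormLex_ne_zero (show 1 ≤ m by omega) m
    unfold powFormLex
    rw [h0, map_zero]
  have hps : IsPolystable p := by
    have h := MS2001_rem_4_1_trace_thm_4_6_analogue_complex hm
    rw [tracePow_eq_powTrace] at h
    exact h.rename_equiv e
  have hN : 0 < m * m := Nat.mul_pos (by omega) (by omega)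
  obtain ⟨k, hk, hHW⟩ := exists_hasHighestWeight_const_of_isPolystable hN (by omega) hp hp0 hps
  refine ⟨k, hk, ?_⟩
  set κ : Fin (m * m) → MatIdx m := fun i => toLex (e.symm i) with hκ
  have hκinj : Function.Injective κ := fun i j hij => e.symm.injective (toLex.injective hij)
  have key := hasHighestWeight_orbitCoordRep_rename_dualOfPartition_iff (k := ℂ) (m := m)
    (matIdxEquiv m) κ hκinj p (by omega) (Nat.Partition.rectangle (m * m) k)
    (Nat.Partition.card_parts_rectangle_le (m * m) k)
  rw [dualOfPartition_rectangle_self, hκ, hpdef, he, rename_powTraceFin_eq_powFormLex m m] at key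
  exact key.mpr hHW

/-- **A constant-weight generator type of `A(Δ_m[tr X_m^m])` of degree `≥ m²`** (`m ≥ 2`): the least
occurring constant weight `χ = -k₀·𝟙_{m²}` has `γ_χ ≠ 0` (least constant weight ⇒ atom ⇒ generator
type) and `m ≤ k₀`, so `-|χ| = k₀ m² ≥ m · m²`. [cite: BurgisserIkenmeyer2017, §3.3] -/
theorem exists_const_genType_self (hm : 2 ≤ m) :
    ∃ χ : Weight (MatIdx m),
      Module.finrank ℂ (↥(highestWeightSpace (orbitCoordRep (powFormLex ℂ m m) m) χ) ⧸
        Submodule.comap (highestWeightSpace (orbitCoordRep (powFormLex ℂ m m) m) χ).subtype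
          (⨆ p : Weight (MatIdx m) × Weight (MatIdx m), ⨆ (_ : p.1 + p.2 = χ ∧ p.1 ≠ 0 ∧ p.2 ≠ 0),
            highestWeightSpace (orbitCoordRep (powFormLex ℂ m m) m) p.1 *
              highestWeightSpace (orbitCoordRep (powFormLex ℂ m m) m) p.2)) ≠ 0 ∧
      (m : ℤ) * ((m * m : ℕ) : ℤ) ≤ -(Weight.size χ) := by
  classical
  obtain ⟨k₀, hk₀pos, hocc, -, hatom⟩ :=
    exists_least_const_atom (powFormLex ℂ m m) m (powFormLex_self_exists_hasHighestWeight_const hm)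
  refine ⟨fun _ => -(k₀ : ℤ), finrank_quotient_ne_zero_of_atom _ (by omega) hocc hatom, ?_⟩
  have hk : m ≤ k₀ := le_of_hasHighestWeight_const (m := m) (e := 0) (by omega) hk₀pos hocc
  rw [size_const_neg, Fintype.card_lex, Fintype.card_prod, Fintype.card_fin, neg_neg]
  push_cast
  have hm0 : (0 : ℤ) ≤ (m : ℤ) * m := by positivity
  have hk' : (m : ℤ) ≤ k₀ := by exact_mod_cast hk
  nlinarith

end Self

section Slice

/-- **The slice regime of `stub_sliceGen` is non-vacuous, with degrees `≥ m²`.** For every `m ≥ 2`,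
every `e` and every final segment `ι : MatIdx m → MatIdx (m + e)` there is a weight `χ` of `GL_{m²}`
with `γ_{ext_ι χ}(tr X_{m+e}^m) ≠ 0` and `-|χ| ≥ m · m²` — the constant-weight generator type of
`A(Δ_m[tr X_m^m])` (`exists_const_genType_self`) transferred along `ι(tr X_m^m) ∈ Δ(tr X_{m+e}^m)`
(tree `rename_powFormLex_mem_orbitClosure`, GIP17 Prop. 5; engine
`finrank_ne_zero_extend_of_rename_mem_orbitClosure`). [cite: GesmundoIkenmeyerPanova2017, Prop. 5] -/
theorem exists_slice_genType_sq_le {m : ℕ} (hm : 2 ≤ m) (e : ℕ)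
    {ι : MatIdx m → MatIdx (m + e)} (hι : StrictMono ι) (hup : IsUpperSet (Set.range ι)) :
    ∃ χ : Weight (MatIdx m),
      Module.finrank ℂ (↥(highestWeightSpace (orbitCoordRep (powFormLex ℂ (m + e) m) m) (Function.extend ι χ 0)) ⧸ Submodule.comap (highestWeightSpace (orbitCoordRep (powFormLex ℂ (m + e) m) m) (Function.extend ι χ 0)).subtype (⨆ p : Weight (MatIdx (m + e)) × Weight (MatIdx (m + e)), ⨆ (_ : p.1 + p.2 = (Function.extend ι χ 0) ∧ p.1 ≠ 0 ∧ p.2 ≠ 0), highestWeightSpace (orbitCoordRep (powFormLex ℂ (m + e) m) m) p.1 * highestWeightSpace (orbitCoordRep (powFormLex ℂ (m + e) m) m) p.2)) ≠ 0 ∧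
      (m : ℤ) * ((m * m : ℕ) : ℤ) ≤ -(Weight.size χ) := by
  obtain ⟨χ, hγ, hdeg⟩ := exists_const_genType_self hm
  refine ⟨χ, ?_, hdeg⟩
  exact finrank_ne_zero_extend_of_rename_mem_orbitClosure hι hup (powFormLex_isHomogeneous ℂ m m)
    (powFormLex_ne_zero (by omega) m) (by omega)
    (rename_powFormLex_mem_orbitClosure (by omega) (Nat.le_add_right m e) ι) χ hγ

/-- The same in the size of the extended weight (`size_extend`): a slice-supported generator type
`ψ = ext_ι χ` of `A(Δ_m[tr X_{m+e}^m])` with `-|ψ| ≥ m · m²`. [cite: GesmundoIkenmeyerPanova2017, Prop. 5] -/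
theorem exists_slice_genType_sq_le' {m : ℕ} (hm : 2 ≤ m) (e : ℕ)
    {ι : MatIdx m → MatIdx (m + e)} (hι : StrictMono ι) (hup : IsUpperSet (Set.range ι)) :
    ∃ ψ : Weight (MatIdx (m + e)), (∀ x, x ∉ Set.range ι → ψ x = 0) ∧
      Module.finrank ℂ (↥(highestWeightSpace (orbitCoordRep (powFormLex ℂ (m + e) m) m) ψ) ⧸ Submodule.comap (highestWeightSpace (orbitCoordRep (powFormLex ℂ (m + e) m) m) ψ).subtype (⨆ p : Weight (MatIdx (m + e)) × Weight (MatIdx (m + e)), ⨆ (_ : p.1 + p.2 = ψ ∧ p.1 ≠ 0 ∧ p.2 ≠ 0), highestWeightSpace (orbitCoordRep (powFormLex ℂ (m + e) m) m) p.1 * highestWeightSpace (orbitCoordRep (powFormLex ℂ (m + e) m) m) p.2)) ≠ 0 ∧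
      (m : ℤ) * ((m * m : ℕ) : ℤ) ≤ -(Weight.size ψ) := by
  obtain ⟨χ, hγ, hdeg⟩ := exists_slice_genType_sq_le hm e hι hup
  refine ⟨Function.extend ι χ 0, fun x hx => ?_, hγ, by rwa [size_extend hι.injective]⟩
  rw [Function.extend_apply' _ _ _ (fun ⟨j, hj⟩ => hx ⟨j, hj⟩), Pi.zero_apply]

end Slice

end

end Summit.ValiantsHypothesis.ValiantsHypothesis.Theorems.GeneratorObstructions.PowGenDegreeQP
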